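import Literature.Analysis.SegalBargmann.HermiteSumOperators
import Literature.Analysis.SegalBargmann.HermiteCoefficientBound
import Mathlib.Analysis.PSeries
import HarnessLib

/-!
# The Hermite coefficients of a Schwartz function are rapidly decreasing (Reed–Simon I, Thm V.13, first half)

Topic `Analysis/SegalBargmann`; namespace `Literature.Analysis.SegalBargmann`.  Continuation of
`Literature.Analysis.SegalBargmann.HermiteCoefficientBound` (`|α|^k ‖c_α(f)‖ ≤ ‖N^k f‖_{L²}`).  Here the uniform bound is
turned into SUMMABILITY statements over the multi-index lattice `ℕ^σ` (`n = |σ|`):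

* §1 counting: `#{β : |β| ≤ m} ≤ (m+1)^n` (`card_degLE_le`), whence the lattice weight
  `Σ_β (|β| + 1)^{−(n+2)} < ∞` (`summable_inv_degree_add_one_pow`);
* §2 `(|α|+1)^j ‖c_α(f)‖ ≤ 2^j (‖f‖_{L²} + ‖N^j f‖_{L²})` and hence, for every `μ`,
  `Σ_α (|α|+1)^μ ‖c_α(f)‖ < ∞` with the explicit bound
  `≤ 2^{μ+n+2} (‖f‖_{L²} + ‖N^{μ+n+2} f‖_{L²}) · Σ_β (|β|+1)^{−(n+2)}` (`summable_degree_pow_mul_norm_hermiteCoeff`,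
  `tsum_degree_pow_mul_norm_hermiteCoeff_le`) — the Hermite coefficients of a Schwartz function are RAPIDLY DECREASING;
* §3 the coefficient functional as a continuous linear functional `hermiteCoeffCLM α : 𝓢(ℝ^σ, ℂ) →L[ℂ] ℂ`
  (Mathlib `SchwartzMap.integralCLM ∘ smulLeftCLM`).

Everything is proved from Mathlib and the imported tree files; no cited fact is used as a hypothesis.

## References

* M. Reed, B. Simon, *Methods of Modern Mathematical Physics I*, Theorem V.13 and the Appendix to §V.3 (the
  `N`-representation of `𝒮(ℝⁿ)`).
* G. B. Folland, *Harmonic Analysis in Phase Space*, Annals of Mathematics Studies 122, Princeton UP (1989), §1.7.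
  [cite: Folland1989, §1.7]

## Provenance

Written for the tree under the LEAN-IN-TREE rule (2026-08-18) by the pub-hodgecm formalisation cell (model-construction
sub-cell, seat mc-binder-2).
-/

set_option autoImplicit false

noncomputable section

open MvPolynomial Complex SchwartzMap MeasureTheory
open scoped BigOperators Real

namespace Literature.Analysis.SegalBargmann

variable {σ : Type*} [Fintype σ] [DecidableEq σ]

/-! ## §1  Counting multi-indices; the lattice weight `(|β|+1)^{−(n+2)}` -/

section Counting

omit [DecidableEq σ] in
/-- **`#{β ∈ ℕ^σ : |β| ≤ m} ≤ (m+1)^{|σ|}`** (each component is `≤ m`). [folklore] -/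
theorem card_degLE_le (m : ℕ) : (degLE m : Finset (σ →₀ ℕ)).card ≤ (m + 1) ^ Fintype.card σ := by
  classical
  have hmaps : Set.MapsTo (fun β : σ →₀ ℕ => (⇑β : σ → ℕ)) ↑(degLE m : Finset (σ →₀ ℕ))
      ↑(Fintype.piFinset fun _ : σ => Finset.range (m + 1)) := by
    intro β hβ
    rw [Finset.mem_coe, mem_degLE] at hβ
    rw [Finset.mem_coe, Fintype.mem_piFinset]
    intro j
    rw [Finset.mem_range]
    exact Nat.lt_succ_of_le ((Finset.single_le_sum (fun i _ => Nat.zero_le (β i)) (Finset.mem_univ j)).trans hβ)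
  have h := Finset.card_le_card_of_injOn (fun β : σ →₀ ℕ => (⇑β : σ → ℕ)) hmaps
    (fun β _ β' _ h => DFunLike.coe_injective h)
  rwa [Fintype.card_piFinset, Finset.prod_const, Finset.card_range, Finset.card_univ] at h

omit [DecidableEq σ] in
/-- **The lattice weight is summable**: `Σ_{β ∈ ℕ^σ} (|β| + 1)^{−(|σ|+2)} < ∞` (group by `|β| = m`: at most `(m+1)^n`
indices, each contributing `(m+1)^{−(n+2)}`; compare with `Σ_m (m+1)^{−2}`). [folklore] -/
theorem summable_inv_degree_add_one_pow :
    Summable fun β : σ →₀ ℕ => (((β.degree : ℝ) + 1) ^ (Fintype.card σ + 2))⁻¹ := by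
  classical
  set n : ℕ := Fintype.card σ with hn
  -- the comparison series `Σ_m ((m+1)^2)⁻¹`
  have hq : Summable fun m : ℕ => (((m : ℝ) + 1) ^ 2)⁻¹ := by
    have h := (summable_nat_add_iff 1).mpr (Real.summable_nat_pow_inv.mpr one_lt_two)
    refine h.congr fun m => ?_
    push_cast
    ring_nf
  refine summable_of_sum_le (fun β => by positivity) (c := ∑' m : ℕ, (((m : ℝ) + 1) ^ 2)⁻¹) fun s => ?_
  -- `s ⊆ degLE M`
  set M : ℕ := s.sup mdeg with hM
  have hsub : s ⊆ degLE M := fun β hβ => mem_degLE.mpr (Finset.le_sup hβ)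
  have hw0 : ∀ β : σ →₀ ℕ, 0 ≤ (((β.degree : ℝ) + 1) ^ (n + 2))⁻¹ := fun β => by positivity
  refine (Finset.sum_le_sum_of_subset_of_nonneg hsub fun β _ _ => hw0 β).trans ?_
  -- group `degLE M` by the exact degree
  have hmaps : ∀ β ∈ (degLE M : Finset (σ →₀ ℕ)), mdeg β ∈ Finset.range (M + 1) := fun β hβ =>
    Finset.mem_range.mpr (Nat.lt_succ_of_le (mem_degLE.mp hβ))
  rw [← Finset.sum_fiberwise_of_maps_to hmaps]
  -- each fibre contributes at most `((m+1)^2)⁻¹`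
  have hfib : ∀ m ∈ Finset.range (M + 1),
      ∑ β ∈ (degLE M : Finset (σ →₀ ℕ)) with mdeg β = m, (((β.degree : ℝ) + 1) ^ (n + 2))⁻¹ ≤
        (((m : ℝ) + 1) ^ 2)⁻¹ := fun m _ => by
    have hconst : ∀ β ∈ (degLE M : Finset (σ →₀ ℕ)).filter (fun β => mdeg β = m),
        (((β.degree : ℝ) + 1) ^ (n + 2))⁻¹ = (((m : ℝ) + 1) ^ (n + 2))⁻¹ := fun β hβ => by
      rw [degree_eq_mdeg, (Finset.mem_filter.mp hβ).2]
    rw [Finset.sum_congr rfl hconst, Finset.sum_const, nsmul_eq_mul]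
    have hcard : (((degLE M : Finset (σ →₀ ℕ)).filter (fun β => mdeg β = m)).card : ℝ) ≤ ((m : ℝ) + 1) ^ n := by
      have h1 : ((degLE M : Finset (σ →₀ ℕ)).filter (fun β => mdeg β = m)).card ≤ (degLE m).card :=
        Finset.card_le_card fun β hβ => mem_degLE.mpr (le_of_eq (Finset.mem_filter.mp hβ).2)
      exact_mod_cast h1.trans (card_degLE_le m)
    have hm0 : (0 : ℝ) < (m : ℝ) + 1 := by positivity
    calc (((degLE M : Finset (σ →₀ ℕ)).filter (fun β => mdeg β = m)).card : ℝ) * (((m : ℝ) + 1) ^ (n + 2))⁻¹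
        ≤ ((m : ℝ) + 1) ^ n * (((m : ℝ) + 1) ^ (n + 2))⁻¹ :=
          mul_le_mul_of_nonneg_right hcard (by positivity)
      _ = (((m : ℝ) + 1) ^ 2)⁻¹ := by
          rw [pow_add, mul_inv, ← mul_assoc, mul_inv_cancel₀ (pow_ne_zero n hm0.ne'), one_mul]
  refine (Finset.sum_le_sum hfib).trans ?_
  exact hq.sum_le_tsum _ fun m _ => by positivity

end Counting

/-! ## §2  Rapid decay of the Hermite coefficients of a Schwartz function -/

section Decay

/-- `(a+1)^j ≤ 2^j (a^j + 1)` for `a ≥ 0`. [folklore] -/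
theorem add_one_pow_le_two_pow_mul {a : ℝ} (ha : 0 ≤ a) (j : ℕ) : (a + 1) ^ j ≤ 2 ^ j * (a ^ j + 1) := by
  induction j with
  | zero => norm_num
  | succ j ih =>
      have hkey : (a + 1) * (a ^ j + 1) ≤ 2 * (a ^ j * a + 1) := by
        -- `a + a^j ≤ a^j a + 1`, i.e. `(a^j − 1)(a − 1) ≥ 0`
        rcases le_total a 1 with h1 | h1
        · have h2 : a ^ j ≤ 1 := pow_le_one₀ ha h1
          nlinarith [mul_nonneg (sub_nonneg.2 h2) (sub_nonneg.2 h1)]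
        · have h2 : 1 ≤ a ^ j := one_le_pow₀ h1
          nlinarith [mul_nonneg (sub_nonneg.2 h2) (sub_nonneg.2 h1)]
      calc (a + 1) ^ (j + 1) = (a + 1) * (a + 1) ^ j := by ring
        _ ≤ (a + 1) * (2 ^ j * (a ^ j + 1)) := mul_le_mul_of_nonneg_left ih (by positivity)
        _ = 2 ^ j * ((a + 1) * (a ^ j + 1)) := by ring
        _ ≤ 2 ^ j * (2 * (a ^ j * a + 1)) := mul_le_mul_of_nonneg_left hkey (by positivity)
        _ = 2 ^ (j + 1) * (a ^ (j + 1) + 1) := by ring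

/-- **`(|α|+1)^j ‖c_α(f)‖ ≤ 2^j (‖f‖_{L²} + ‖N^j f‖_{L²})`**, uniformly in `α`. [cite: Folland1989, §1.7] -/
theorem degree_add_one_pow_mul_norm_hermiteCoeff_le (α : σ →₀ ℕ) (j : ℕ) (f : 𝓢(EuclideanSpace ℝ σ, ℂ)) :
    ((α.degree : ℝ) + 1) ^ j * ‖hermiteCoeff α f‖ ≤
      2 ^ j * (Real.sqrt (∫ x : EuclideanSpace ℝ σ, ‖f x‖ ^ 2) +
        Real.sqrt (∫ x : EuclideanSpace ℝ σ, ‖((numberOpCLM ^ j) f) x‖ ^ 2)) := by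
  have h0 := norm_hermiteCoeff_le α f
  have hj := degree_pow_mul_norm_hermiteCoeff_le α j f
  have hc := norm_nonneg (hermiteCoeff α f)
  calc ((α.degree : ℝ) + 1) ^ j * ‖hermiteCoeff α f‖
      ≤ 2 ^ j * ((α.degree : ℝ) ^ j + 1) * ‖hermiteCoeff α f‖ :=
        mul_le_mul_of_nonneg_right (add_one_pow_le_two_pow_mul (Nat.cast_nonneg _) j) hc
    _ = 2 ^ j * (‖hermiteCoeff α f‖ + (α.degree : ℝ) ^ j * ‖hermiteCoeff α f‖) := by ring
    _ ≤ 2 ^ j * (Real.sqrt (∫ x : EuclideanSpace ℝ σ, ‖f x‖ ^ 2) +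
          Real.sqrt (∫ x : EuclideanSpace ℝ σ, ‖((numberOpCLM ^ j) f) x‖ ^ 2)) := by
        gcongr

/-- **The Hermite coefficients of a Schwartz function are rapidly decreasing**: for every `μ`,
`Σ_α (|α|+1)^μ ‖c_α(f)‖ < ∞`. [cite: Folland1989, §1.7] -/
theorem summable_degree_pow_mul_norm_hermiteCoeff (μ : ℕ) (f : 𝓢(EuclideanSpace ℝ σ, ℂ)) :
    Summable fun α : σ →₀ ℕ => ((α.degree : ℝ) + 1) ^ μ * ‖hermiteCoeff α f‖ := by
  set n : ℕ := Fintype.card σ with hn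
  set K : ℝ := 2 ^ (μ + (n + 2)) * (Real.sqrt (∫ x : EuclideanSpace ℝ σ, ‖f x‖ ^ 2) +
    Real.sqrt (∫ x : EuclideanSpace ℝ σ, ‖((numberOpCLM ^ (μ + (n + 2))) f) x‖ ^ 2)) with hK
  refine (summable_inv_degree_add_one_pow.mul_left K).of_nonneg_of_le (fun α => by positivity) fun α => ?_
  have hα : (0 : ℝ) < (α.degree : ℝ) + 1 := by positivity
  have h := degree_add_one_pow_mul_norm_hermiteCoeff_le α (μ + (n + 2)) f
  rw [← hK, pow_add, mul_assoc] at h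
  -- divide by `(|α|+1)^{n+2}`
  rw [← hn]
  calc ((α.degree : ℝ) + 1) ^ μ * ‖hermiteCoeff α f‖
      = ((α.degree : ℝ) + 1) ^ μ * (((α.degree : ℝ) + 1) ^ (n + 2) * ‖hermiteCoeff α f‖) *
          (((α.degree : ℝ) + 1) ^ (n + 2))⁻¹ := by
        field_simp
    _ ≤ K * (((α.degree : ℝ) + 1) ^ (n + 2))⁻¹ := mul_le_mul_of_nonneg_right h (by positivity)

/-- The explicit bound: `Σ_α (|α|+1)^μ ‖c_α(f)‖ ≤ 2^{μ+n+2} (‖f‖_{L²} + ‖N^{μ+n+2} f‖_{L²}) · Σ_β (|β|+1)^{−(n+2)}`.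
[cite: Folland1989, §1.7] -/
theorem tsum_degree_pow_mul_norm_hermiteCoeff_le (μ : ℕ) (f : 𝓢(EuclideanSpace ℝ σ, ℂ)) :
    ∑' α : σ →₀ ℕ, ((α.degree : ℝ) + 1) ^ μ * ‖hermiteCoeff α f‖ ≤
      2 ^ (μ + (Fintype.card σ + 2)) * (Real.sqrt (∫ x : EuclideanSpace ℝ σ, ‖f x‖ ^ 2) +
        Real.sqrt (∫ x : EuclideanSpace ℝ σ, ‖((numberOpCLM ^ (μ + (Fintype.card σ + 2))) f) x‖ ^ 2)) *
        ∑' β : σ →₀ ℕ, (((β.degree : ℝ) + 1) ^ (Fintype.card σ + 2))⁻¹ := by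
  set n : ℕ := Fintype.card σ with hn
  set K : ℝ := 2 ^ (μ + (n + 2)) * (Real.sqrt (∫ x : EuclideanSpace ℝ σ, ‖f x‖ ^ 2) +
    Real.sqrt (∫ x : EuclideanSpace ℝ σ, ‖((numberOpCLM ^ (μ + (n + 2))) f) x‖ ^ 2)) with hK
  rw [← tsum_mul_left]
  refine (summable_degree_pow_mul_norm_hermiteCoeff μ f).tsum_le_tsum (fun α => ?_)
    (summable_inv_degree_add_one_pow.mul_left K)
  have h := degree_add_one_pow_mul_norm_hermiteCoeff_le α (μ + (n + 2)) f
  rw [← hK, pow_add, mul_assoc] at h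
  calc ((α.degree : ℝ) + 1) ^ μ * ‖hermiteCoeff α f‖
      = ((α.degree : ℝ) + 1) ^ μ * (((α.degree : ℝ) + 1) ^ (n + 2) * ‖hermiteCoeff α f‖) *
          (((α.degree : ℝ) + 1) ^ (n + 2))⁻¹ := by
        field_simp
    _ ≤ K * (((α.degree : ℝ) + 1) ^ (n + 2))⁻¹ := mul_le_mul_of_nonneg_right h (by positivity)

/-- In particular `Σ_α ‖c_α(f)‖ < ∞`. [cite: Folland1989, §1.7] -/
theorem summable_norm_hermiteCoeff (f : 𝓢(EuclideanSpace ℝ σ, ℂ)) :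
    Summable fun α : σ →₀ ℕ => ‖hermiteCoeff α f‖ := by
  simpa using summable_degree_pow_mul_norm_hermiteCoeff 0 f

end Decay

/-! ## §3  The coefficient functionals are continuous -/

section Functional

/-- **The Hermite coefficient functional `c_α : 𝓢(ℝ^σ, ℂ) →L[ℂ] ℂ`** (`f ↦ ∫ h_α f`; Mathlib's `integralCLM` after
multiplication by the Schwartz function `h_α`). [folklore] -/
def hermiteCoeffCLM (α : σ →₀ ℕ) : 𝓢(EuclideanSpace ℝ σ, ℂ) →L[ℂ] ℂ :=
  (SchwartzMap.integralCLM ℂ (volume : Measure (EuclideanSpace ℝ σ))).comp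
    (SchwartzMap.smulLeftCLM ℂ (⇑(hermiteSchwartz (herm α))))

/-- `hermiteCoeffCLM α f = hermiteCoeff α f`. [folklore] -/
@[simp]
theorem hermiteCoeffCLM_apply (α : σ →₀ ℕ) (f : 𝓢(EuclideanSpace ℝ σ, ℂ)) :
    hermiteCoeffCLM α f = hermiteCoeff α f := by
  rw [hermiteCoeffCLM, ContinuousLinearMap.comp_apply, SchwartzMap.integralCLM_apply, hermiteCoeff_apply]
  refine integral_congr_ae (Filter.Eventually.of_forall fun x => ?_)
  show SchwartzMap.smulLeftCLM ℂ (⇑(hermiteSchwartz (herm α))) f x = hermiteSchwartz (herm α) x * f x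
  rw [SchwartzMap.smulLeftCLM_apply_apply (hermiteSchwartz (herm α)).hasTemperateGrowth, smul_eq_mul]

/-- **The coefficient functional `f ↦ c_α(f)` is continuous on `𝓢(ℝ^σ, ℂ)`.** [folklore] -/
theorem continuous_hermiteCoeff (α : σ →₀ ℕ) :
    Continuous fun f : 𝓢(EuclideanSpace ℝ σ, ℂ) => hermiteCoeff α f := by
  exact (hermiteCoeffCLM α).continuous.congr fun f => hermiteCoeffCLM_apply α f

end Functional

end Literature.Analysis.SegalBargmann

end
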